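import Summits.RiemannHypothesis.RiemannHypothesis.Theses.WeilComb
import Summits.RiemannHypothesis.RiemannHypothesis.Theorems.CombShapePositivity.Negative.WeilCombCombShapePositivityLoadBearing
import Summits.RiemannHypothesis.RiemannHypothesis.Theorems.WeilCombCombShapePositivityFejerOfCrux
import Literature.NumberTheory.LFunctions.WeilExplicit

/-!
# Strategy census for the crux `WeilComb.CombShapePositivity` (stmt-RiemannHypothesis-11229) — typed attempts

Companion of `STRATEGY-CENSUS.md` (crux-strategist seat planner-cstrat-stmt-RiemannHypothesis-11229-0,
2026-08-16). Every lens of the census (TRANSFER / STRENGTHEN / DECOMPOSITION / NEGATION) is recorded here as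
Lean `Prop`s over the route's own objects, together with the cheap implications that decide whether the
language switch has teeth. Nothing here is a stub of a line; nothing is sorried. The verdicts (why each
attempt gives no leverage short of the summit) are in the markdown census; the docstrings point to them.

Notation: `comb ε M a = Σ_{m ≤ M} a m · φ_ε(· − log m)` (verbatim body of the crux),
`Q(g) = weilQuadratic g = W(g ⋆ g̃)`, `w_ε(x) = W(τ_x (φ_ε ⋆ φ̃_ε))` (comb symbol).
-/

noncomputable section

set_option linter.dupNamespace false

open scoped BigOperators ComplexConjugate
open Complex

namespace Summit.RiemannHypothesis.RiemannHypothesis.Cruxes.CombShapePositivity.StrategyCensus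

open Literature.NumberTheory.LFunctions
open Summit.RiemannHypothesis.RiemannHypothesis.Theses.WeilComb

/-! ## §0 The crux's own objects -/

/-- The fixed-shape comb of the crux, verbatim. [folklore] -/
def comb (ε : ℝ) (M : ℕ) (a : ℕ → ℂ) : ℝ → ℂ :=
  fun x : ℝ => ∑ m ∈ Finset.Icc 1 M,
    a m * ((ε : ℂ)⁻¹ * ((expNegInvGlue (1 - ((x - Real.log (m : ℝ)) / ε) ^ 2) : ℝ) : ℂ))

/-- One cell `(ε, M)`: positivity for every coefficient vector. [folklore] -/
def Cell (ε : ℝ) (M : ℕ) : Prop := ∀ a : ℕ → ℂ, 0 ≤ (weilQuadratic (comb ε M a)).re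

/-- The crux is literally `∀ ε > 0, ∀ M, Cell ε M`. [folklore] -/
theorem crux_iff : CombShapePositivity ↔ ∀ ε : ℝ, 0 < ε → ∀ M : ℕ, Cell ε M := Iff.rfl

/-- `RH ⇒ crux` (Weil's easy direction + the explicit formula; landed Negative file, contraposed). [folklore] -/
theorem crux_of_riemannHypothesis (hRH : RiemannHypothesis) : CombShapePositivity := by
  by_contra h
  exact Summit.RiemannHypothesis.RiemannHypothesis.Theorems.weilComb_not_riemannHypothesis_of_not_combShapePositivity
    h hRH

/-! ## §1 DECOMPOSITION attempts

(D1) the window split `Window C ∧ Beyond C → crux`; (D2) its verdict: `Beyond C` is already the whole crux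
(co-finality), so the split is `crux-in-costume ∧ theorem`; (D3) coefficient-class splits: the minimal co-final
face `TwoNodeFlat` (the `(1,1)`-weighted `2 × 2` minors at integer lags) is RH-complete by LANDAU'S THEOREM
(census §Decomposition/§Negation), so any split `Structured ∧ Rest` with `TwoNodeFlat ⊆ Rest` has `Rest ≡ crux`. -/

/-- **Window(C)** — the bounded-window rung `ε·M ≤ C` (Theorem A: `C = c₀`; Theorem B: `2ε(M+1) ≤ 1`; believed
unconditional for every fixed `C`, precision ladder Disproof N4b). [conjecture] -/
def Window (C : ℝ) : Prop :=
  ∀ ε : ℝ, 0 < ε → ∀ (M : ℕ) (a : ℕ → ℂ), ε * M ≤ C → 0 ≤ (weilQuadratic (comb ε M a)).re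

/-- **Beyond(C)** — the complementary regime `C < ε·M`. [conjecture] -/
def Beyond (C : ℝ) : Prop :=
  ∀ ε : ℝ, 0 < ε → ∀ (M : ℕ) (a : ℕ → ℂ), C < ε * M → 0 ≤ (weilQuadratic (comb ε M a)).re

/-- (D1) The crux is the conjunction of ALL windows (take `C = ε·M`). [folklore] -/
theorem crux_iff_forall_window : CombShapePositivity ↔ ∀ C : ℝ, Window C :=
  ⟨fun h _ ε hε M a _ => h ε hε M a, fun h ε hε M a => h (ε * M) ε hε M a le_rfl⟩

/-- (D1) The window split is a valid composition … [folklore] -/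
theorem crux_of_window_of_beyond (C : ℝ) (hW : Window C) (hB : Beyond C) : CombShapePositivity := by
  intro ε hε M a
  rcases le_or_gt (ε * M) C with h | h
  · exact hW ε hε M a h
  · exact hB ε hε M a h

/-- (D2) … but its second piece is the crux in costume: `Beyond C ↔ CombShapePositivity` for EVERY `C`, because the
cells `{(ε, M) : C < εM}` are co-final in `M` at each `ε` (extend coefficients by zero; tree:
`combShapePositivity_iff_cofinal`). [folklore] -/
theorem beyond_iff_crux (C : ℝ) : Beyond C ↔ CombShapePositivity := by
  have hcof := Summit.RiemannHypothesis.RiemannHypothesis.Theorems.WeilCombBohrFejer.combShapePositivity_iff_cofinal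
    (fun ε M => C < ε * M) (fun ε hε M₀ => ?_)
  · rw [hcof]
    constructor
    · intro h ε hε M hM a
      exact h ε hε M a hM
    · intro h ε hε M a hM
      exact h ε hε M hM a
  · -- co-finality: some `M ≥ M₀` has `C < ε M`
    obtain ⟨N, hN⟩ := exists_nat_gt (C / ε)
    refine ⟨max M₀ N, le_max_left _ _, ?_⟩
    have hN' : C / ε < ((max M₀ N : ℕ) : ℝ) := lt_of_lt_of_le hN (by exact_mod_cast le_max_right M₀ N)
    rwa [div_lt_iff₀ hε, mul_comm] at hN'

/-- **TwoNodeFlat** — the minimal co-final face: the flat two-node combs `φ_ε + φ_ε(· − log m)`, i.e. the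
inequalities `w_ε(0) + w_ε(log m) ≥ 0` (`m ≥ 1`, `ε > 0`): the `(1,1)`-weighted `2 × 2` principal minors at integer
lags. RH-implied (sub-statement of the crux); RH-COMPLETE by Landau's theorem on Dirichlet series with non-negative
coefficients (census §Negation: `Σ_m (w_ε(log m) + w_ε(0)) m^{-s} = Σ_ρ Ψ_ε(ρ) ζ(s − ρ + ½) + w_ε(0) ζ(s)`).
[conjecture] -/
def TwoNodeFlat : Prop :=
  ∀ ε : ℝ, 0 < ε → ∀ m : ℕ, 1 ≤ m →
    0 ≤ (weilQuadratic (comb ε m (fun k => if k = 1 ∨ k = m then 1 else 0))).re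

/-- `TwoNodeFlat` is a sub-statement of the crux (restriction to `a = 1_{{1, m}}`, level `m`). [folklore] -/
theorem twoNodeFlat_of_crux (h : CombShapePositivity) : TwoNodeFlat :=
  fun ε hε m _ => h ε hε m _

/-- **Landau detection** (claimed provable, size L; Montgomery–Vaughan Thm 1.7 / Lemma 15.1 mechanism applied to the
Dirichlet series of the symbol values at integer lags; the weight `Ψ_ε(ρ) = Φ₀(ε(ρ−½)) Φ₀(ε(½−ρ))` is non-zero at
every zero for all but countably many `ε`). [conjecture] -/
def TwoNodeFlatDetects : Prop := TwoNodeFlat → RiemannHypothesis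

/-- (D3) Hence the minimal face already carries the whole crux: given Landau detection, `TwoNodeFlat ↔ crux`.
[folklore] -/
theorem twoNodeFlat_iff_crux (hL : TwoNodeFlatDetects) : TwoNodeFlat ↔ CombShapePositivity :=
  ⟨fun h => crux_of_riemannHypothesis (hL h), twoNodeFlat_of_crux⟩

/-- (D3) Any coefficient-class split whose "unstructured" piece contains the flat two-node combs has that piece
equivalent to the crux. [folklore] -/
theorem rest_iff_crux_of_twoNodeFlat (hL : TwoNodeFlatDetects) {Rest : Prop}
    (hsub : CombShapePositivity → Rest) (hface : Rest → TwoNodeFlat) : Rest ↔ CombShapePositivity :=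
  ⟨fun h => (twoNodeFlat_iff_crux hL).mp (hface h), hsub⟩

/-! ## §2 STRENGTHEN attempts

(S1) the Bohr/CM-cone strengthening IS the registered line's `stub_fejer` (tree: `combShapePositivity_iff_fejer`);
(S2) structured-coefficient strengthenings (judge's "what would move it"): fixed profiles are SUB-statements and
RH-FREE (Perron ray: leading constant = the unconditional Hadamard constant `Σ_ρ 1/(ρ(1−ρ)) = 2 + γ − log 4π`);
(S3) a quantitative margin `f(εM) > 0` is STRONGER than the crux and needs the same precision `f(C)/κ`;
(S4) monotonicity in `ε` (reduction to a limit) is false termwise (census). -/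

/-- (S2) **PerronRayPositivity** — the crux on the single ray `a_m = m^{-1/2}` (the extremal direction to leading
order, Disproof N2). Sub-statement; RH-free (census §Strengthen F2). [conjecture] -/
def PerronRayPositivity : Prop :=
  ∀ ε : ℝ, 0 < ε → ∀ M : ℕ, 0 ≤ (weilQuadratic (comb ε M (fun m => ((Real.sqrt (m : ℝ) : ℝ) : ℂ)⁻¹))).re

/-- (S2) **ProfilePositivity f** — the crux along one fixed smooth profile `a_m = f(m/M) m^{-1/2}` (tapered Perron,
Möbius-free structured families). Sub-statement; RH-free for each fixed `f` (census). [conjecture] -/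
def ProfilePositivity (f : ℝ → ℝ) : Prop :=
  ∀ ε : ℝ, 0 < ε → ∀ M : ℕ,
    0 ≤ (weilQuadratic (comb ε M (fun m => ((f ((m : ℝ) / M) / Real.sqrt (m : ℝ) : ℝ) : ℂ)))).re

/-- (S2) Structured families are restrictions of the crux (so they cannot be stronger; the census explains why they
are in fact RH-free, hence no leverage). [folklore] -/
theorem perronRay_of_crux (h : CombShapePositivity) : PerronRayPositivity := fun ε hε M => h ε hε M _

/-- (S2) idem for every profile. [folklore] -/
theorem profile_of_crux (h : CombShapePositivity) (f : ℝ → ℝ) : ProfilePositivity f := fun ε hε M => h ε hε M _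

/-- (S3) **QuantMargin** — a uniform positive margin `f(εM)` in units `ε⁻¹‖φ₀‖₂²‖a‖²` (numerically
`f(C) ≈ e^{-4.8 − 5.3(√C − 1)}`, Disproof N1). STRONGER than the crux; its proof needs prime-sum constants to
precision `f(C)/κ` uniformly (N4b), i.e. exactly the obstruction of the crux plus a zero-spacing statement.
[conjecture] -/
def QuantMargin : Prop :=
  ∃ f : ℝ → ℝ, (∀ C : ℝ, 0 < f C) ∧ ∀ ε : ℝ, 0 < ε → ∀ (M : ℕ) (a : ℕ → ℂ),
    f (ε * M) * (ε⁻¹ * weilNorm2Sq (fun u : ℝ => ((expNegInvGlue (1 - u ^ 2) : ℝ) : ℂ)) *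
        ∑ m ∈ Finset.Icc 1 M, ‖a m‖ ^ 2) ≤ (weilQuadratic (comb ε M a)).re

/-- (S3) `QuantMargin → crux` is routine (the margin is non-negative) — so it is an admissible S⁺; the census records
why the added rigidity buys nothing (no induction/compactness in `C`; margin `→ 0` faster than any zero-free input).
[folklore] -/
theorem crux_of_quantMargin (h : QuantMargin) : CombShapePositivity := by
  obtain ⟨f, hf, hQ⟩ := h
  intro ε hε M a
  refine le_trans ?_ (hQ ε hε M a)
  refine mul_nonneg (hf _).le (mul_nonneg (mul_nonneg (inv_nonneg.mpr hε.le) ?_) ?_)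
  · exact MeasureTheory.integral_nonneg fun _ => by positivity
  · exact Finset.sum_nonneg fun _ _ => by positivity

/-! ## §3 TRANSFER attempts

(T1) function field (Weil 1948; Toeplitz reading Hallouin–Perret doi:10.1090/tran/7813): Frobenius powers ↦ powers
of ONE prime — the one-prime tower (crux idea `frobenius-tower-toeplitz`); (T2) all primes at once ↦ the Bohr torus
(= `stub_fejer`). On a tower, PSD of the Toeplitz sections is EQUIVALENT to boundedness of the symbol values
(`|c_j| ≤ c_0` is the `2 × 2` minor; boundedness along `p^j` is already quasi-RH by bounded power sums / Landau), so
the transferred structure (Carathéodory–Toeplitz, Schur, OPUC) constrains nothing beyond the classical growth face. -/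

/-- (T1) **TowerPositivity p** — the crux restricted to coefficient vectors supported on the geometric nodes
`p^j, j ≤ J` (Toeplitz sections `[w_ε((j−k) log p)]`). Sub-statement of the crux. [conjecture] -/
def TowerPositivity (p : ℕ) : Prop :=
  ∀ ε : ℝ, 0 < ε → ∀ (J : ℕ) (c : ℕ → ℂ),
    0 ≤ (weilQuadratic (comb ε (p ^ J)
      (fun m => if m ∈ (Finset.range (J + 1)).image (p ^ ·) then c (Nat.log p m) else 0))).re

/-- (T1) towers are restrictions of the crux. [folklore] -/
theorem tower_of_crux (h : CombShapePositivity) (p : ℕ) : TowerPositivity p := fun ε hε J _ => h ε hε (p ^ J) _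

/-- (T1) **TowerFlat p** — the flat two-node tower values: `w_ε(0) + w_ε(j log p) ≥ 0` for all `j` (one-sided;
the `(1,1)` minors of the tower). The two-sided minors `|c_j| ≤ c_0` at all small `ε` already give RH (bounded power
sums on `ℕ log p`, tree `BoundedPowerSum.sum_fiber_eq_zero_of_exp_real`; the fibre sums of an off-line class are non-zero
for small `ε`), so Toeplitz POSITIVITY adds nothing to Toeplitz BOUNDEDNESS on towers (census F3); the one-sided version
has the real-pole caveat `γ ∈ (2π/log p)ℤ` in Landau's argument, removed by a second prime. [conjecture] -/
def TowerFlat (p : ℕ) : Prop :=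
  ∀ ε : ℝ, 0 < ε → ∀ j : ℕ,
    0 ≤ (weilQuadratic (comb ε (p ^ j) (fun k => if k = 1 ∨ k = p ^ j then 1 else 0))).re

/-- (T1) `TowerFlat p` is the `m = p^j` slice of `TwoNodeFlat`. [folklore] -/
theorem towerFlat_of_twoNodeFlat (h : TwoNodeFlat) (p : ℕ) (hp : 1 ≤ p) : TowerFlat p :=
  fun ε hε j => h ε hε (p ^ j) (Nat.one_le_pow j p hp)

/-! ## §4 NEGATION

A counterexample to the crux is a counterexample to RH (`crux_of_riemannHypothesis`), so none is accessible; the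
structural content of the negation lens is the SHAPE of a minimal counterexample: by Landau detection, if the crux
fails it fails on a flat two-node comb. -/

/-- (N) Minimal counterexamples are flat two-node combs (given Landau detection). [folklore] -/
theorem not_twoNodeFlat_of_not_crux (hL : TwoNodeFlatDetects) (h : ¬ CombShapePositivity) : ¬ TwoNodeFlat :=
  fun hT => h (crux_of_riemannHypothesis (hL hT))

/-- (N) … equivalently: a failing cell forces a failing flat pair `(1, m)` at some shape `ε`. [folklore] -/
theorem exists_flat_pair_of_not_crux (hL : TwoNodeFlatDetects) (h : ¬ CombShapePositivity) :
    ∃ ε : ℝ, 0 < ε ∧ ∃ m : ℕ, 1 ≤ m ∧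
      (weilQuadratic (comb ε m (fun k => if k = 1 ∨ k = m then 1 else 0))).re < 0 := by
  have hT := not_twoNodeFlat_of_not_crux hL h
  simp only [TwoNodeFlat, not_forall, not_le] at hT
  obtain ⟨ε, hε, m, hm, hlt⟩ := hT
  exact ⟨ε, hε, m, hm, hlt⟩

end Summit.RiemannHypothesis.RiemannHypothesis.Cruxes.CombShapePositivity.StrategyCensus

end
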